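import Literature.NumberTheory.EllipticCurves.WeilPairingProofs
import Literature.NumberTheory.EllipticCurves.ZpExtensionProofs
import Literature.NumberTheory.EllipticCurves.AnticyclotomicCompactSelmer
import Literature.NumberTheory.EllipticCurves.SelmerGaloisAction
import HarnessLib

/-!
# T1 JET (cell `bsd-jet`), road K, input (W1): a Weil pairing on `E[N](K̄)` for `E` defined over `ℚ`
# which is equivariant under EVERY `ℚ`-automorphism of `K̄` (in particular under the lifts of complex
# conjugation) — the hypothesis `hτe` of the row-duality files, DISCHARGED

HONEST FRAMING (programme file `BSD-LIT2PART-PROGRAMME-v1.md` §HONESTY, verbatim): «no tranche here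
proves BSD; ARM L moves the LITERAL column of an r ≤ 1 census into the kernel-proved-modulo-named-print
column; ARM P changes what «named print» is worth.» THEOREMS ONLY (seat `bsd-jet-pv-1`, session g5;
`--supports stmt-BirchSwinnertonDyer-14418`, helper): no definition, no named fact, no `sorry`.
Nothing is booked; 0 classes move.

## What

For `W/ℚ`, a number field `K` and `N ≥ 2`: the tree's PROVED Weil pairing
(`WeierstrassCurve.exists_weilPairing_holds W N` over `ℚ`, Silverman III.8.1: bilinear, alternating,
non-degenerate, `μ_N`-valued, `Γ_ℚ`-equivariant, on `E[N](ℚ̄)`) transported along the pinned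
identification `e : ℚ̄ ≃ₐ[ℚ] K̄` (`absClosureEquiv ℚ K`) to `E[N](K̄) = geomTorsion (W⁄K) N` is
equivariant under every `ℚ`-algebra automorphism `φ` of `K̄` (each is `e g e⁻¹`, `g ∈ Γ_ℚ`:
`absGaloisTransport`):
* `exists_weilPairing_outerConj_equivariant` — `∃ e_K` with the five algebraic properties of
  `exists_weilPairing` AND `ĝ (e_K S T) = e_K (ĝS) (ĝT)` for every `g ∈ Γ_ℚ` (`ĝ = absGaloisTransportRat K g`,
  `ĝS = geomTorsionOuterConj … g … S`, the tree's Howard-§2.3 vocabulary);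
* `exists_weilPairing_liftEquivariant` — the same packaged for the consumers: `Γ_K`-equivariance
  (`hgal`) and, for every `σ ∈ Aut(K/ℚ)` and every lift `τ` of `σ` to `K̄` (`IsLiftOfAut`),
  `τ (e_K S T) = e_K (τ_* S) (τ_* T)` with `τ_* = IsLiftOfAut.torsionMap` — the hypothesis `hτe` of
  `GlobalDuality.exists_rowDuality[_modified]` and `JET.tamagawaExponent_le_mInfty_of_kernelInputs_duality`.

References (locators only; no cited FACT is declared): [cite: SilvermanAEC2009, Prop. III.8.1 (a)–(d)
(Galois invariance over the field of definition `ℚ`)] [cite: Howard2004HeegnerKolyvagin, §2.3 (action of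
complex conjugation on `T` for `E/ℚ`)]. Design: no definitions; `K : Type`. Axioms: `propext`,
`Classical.choice`, `Quot.sound`.
-/

set_option autoImplicit false

noncomputable section

open scoped Classical
open Function Field WeierstrassCurve
open Literature.NumberTheory.EllipticCurves Literature.NumberTheory.GaloisRepresentations

namespace Summit.BirchSwinnertonDyer.Rank1Residual.JET.GlobalDuality

section WeilDatum

variable (W : WeierstrassCurve ℚ) [W.IsElliptic] (K : Type) [Field K] [NumberField K]

/-- **A Weil pairing on `E[N](K̄)` equivariant under every `ℚ`-automorphism of `K̄`**, for `E = W`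
defined over `ℚ` and `N ≥ 2`: transport of the tree's Weil pairing over `ℚ`
(`exists_weilPairing_holds W N`, Silverman III.8.1) along `absClosureEquiv ℚ K : ℚ̄ ≃ₐ[ℚ] K̄`; every
`φ : K̄ ≃ₐ[ℚ] K̄` is the transport of some `g ∈ Γ_ℚ` (`absGaloisTransport`), under which the pairing
over `ℚ` is equivariant. [cite: SilvermanAEC2009, Prop. III.8.1 (a)–(d)] -/
theorem exists_weilPairing_outerConj_equivariant (N : ℕ) (hN : 2 ≤ N) :
    ∃ e : geomTorsion (W.baseChange K) N → geomTorsion (W.baseChange K) N → AlgebraicClosure K,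
      (∀ S T, e S T ^ N = 1) ∧
      (∀ S₁ S₂ T, e (S₁ + S₂) T = e S₁ T * e S₂ T) ∧
      (∀ S T₁ T₂, e S (T₁ + T₂) = e S T₁ * e S T₂) ∧
      (∀ T, e T T = 1) ∧
      (∀ T, (∀ S, e S T = 1) → T = 0) ∧
      ∀ (g : absoluteGaloisGroup ℚ) (S T : geomTorsion (W.baseChange K) N),
        absGaloisTransportRat K g (e S T) =
          e (W.geomTorsionOuterConj K g N S) (W.geomTorsionOuterConj K g N T) := by
  haveI : NeZero N := ⟨by omega⟩
  -- the Weil pairing over `ℚ`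
  obtain ⟨e₀, hμ₀, hadd₁₀, hadd₂₀, halt₀, hnd₀, hgal₀⟩ := exists_weilPairing_holds W N hN
    (Nat.cast_ne_zero.mpr (NeZero.ne N))
  -- the pinned identification `ε : ℚ̄ ≃ K̄` and the induced transports of points
  set ε := absClosureEquiv ℚ K with hε
  let Ψ : geomPoints (W.baseChange K) →+ geomPoints W := Affine.Point.map (W' := W) ε.symm.toAlgHom
  let Φ : geomPoints W →+ geomPoints (W.baseChange K) := Affine.Point.map (W' := W) ε.toAlgHom
  have hΨΦ : ∀ P, Ψ (Φ P) = P := fun P => by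
    change (W.baseChange (AlgebraicClosure ℚ)).toAffine.Point at P
    rcases P with _ | ⟨x, y, h⟩
    · rfl
    · exact Affine.Point.some_eq_some_of_eq (ε.symm_apply_apply x) (ε.symm_apply_apply y)
  have hΦΨ : ∀ P, Φ (Ψ P) = P := fun P => by
    change ((W.baseChange K).baseChange (AlgebraicClosure K)).toAffine.Point at P
    rcases P with _ | ⟨x, y, h⟩
    · rfl
    · exact Affine.Point.some_eq_some_of_eq (ε.apply_symm_apply x) (ε.apply_symm_apply y)
  have hΨinj : Injective Ψ := LeftInverse.injective (g := Φ) hΦΨ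
  -- restriction to the `N`-torsion (`geomPoints (W⁄K)` is the type of points of `W` over `K̄`)
  have hΨtors : ∀ S : geomTorsion (W.baseChange K) N,
      Ψ (S : geomPoints (W.baseChange K)) ∈ geomTorsion W N := fun S => by
    rw [mem_geomTorsion_iff]
    have hS : (N : ℤ) • (S : geomPoints (W.baseChange K)) = 0 := (mem_geomTorsion_iff _ _ _).mp S.2
    have := congrArg Ψ hS
    rwa [map_zsmul, map_zero] at this
  have hΦtors : ∀ S : geomTorsion W N, (Φ (S : geomPoints W) : geomPoints (W.baseChange K)) ∈
      geomTorsion (W.baseChange K) N := fun S => by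
    rw [mem_geomTorsion_iff]
    have hS : (N : ℤ) • (S : geomPoints W) = 0 := (mem_geomTorsion_iff _ _ _).mp S.2
    have := congrArg Φ hS
    rwa [map_zsmul, map_zero] at this
  let ψ : geomTorsion (W.baseChange K) N → geomTorsion W N := fun S => ⟨Ψ (S : geomPoints _), hΨtors S⟩
  have hψ : ∀ S, ((ψ S : geomTorsion W N) : geomPoints W) = Ψ (S : geomPoints (W.baseChange K)) :=
    fun _ => rfl
  have hψadd : ∀ S₁ S₂, ψ (S₁ + S₂) = ψ S₁ + ψ S₂ := fun S₁ S₂ => Subtype.ext (by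
    rw [hψ, AddSubgroup.coe_add, AddSubgroup.coe_add, map_add, hψ, hψ])
  -- the transported pairing
  refine ⟨fun S T => ε (e₀ (ψ S) (ψ T)), fun S T => ?_, fun S₁ S₂ T => ?_, fun S T₁ T₂ => ?_,
    fun T => ?_, fun T hT => ?_, fun g S T => ?_⟩
  · beta_reduce; rw [← map_pow, hμ₀, map_one]
  · beta_reduce; rw [hψadd, hadd₁₀, map_mul]
  · beta_reduce; rw [hψadd, hadd₂₀, map_mul]
  · exact (congrArg ε (halt₀ _)).trans (map_one ε)
  · -- non-degeneracy: `ψ` is injective and surjective onto `E[N](ℚ̄)`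
    have h1 : ψ T = 0 := by
      refine hnd₀ _ fun S₀ => ?_
      have hS₀ : ψ ⟨Φ (S₀ : geomPoints W), hΦtors S₀⟩ = S₀ := Subtype.ext (hΨΦ _)
      have h := hT ⟨Φ (S₀ : geomPoints W), hΦtors S₀⟩
      beta_reduce at h
      rw [hS₀] at h
      exact (map_eq_one_iff ε ε.injective).mp h
    have h2 : Ψ (T : geomPoints (W.baseChange K)) = 0 := by rw [← hψ, h1]; rfl
    exact Subtype.ext (hΨinj (h2.trans (map_zero Ψ).symm))
  · -- equivariance under `ĝ = ε g ε⁻¹`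
    have hval : ∀ z : AlgebraicClosure ℚ, absGaloisTransportRat K g (ε z) = ε (g • z) := fun z => by
      change absGaloisTransport (K := ℚ) (L := K) g (ε z) = ε (g • z)
      rw [absGaloisTransport_apply, AlgEquiv.symm_apply_apply]
    have hval' : ∀ y : AlgebraicClosure K, ε.symm (absGaloisTransportRat K g y) = g • ε.symm y :=
      fun y => by
        apply ε.injective
        rw [AlgEquiv.apply_symm_apply, ← hval, AlgEquiv.apply_symm_apply]
    have hsmul : ∀ P : geomPoints W, g • P = Affine.Point.map (W' := W)
        (absoluteGaloisGroup.toAlgEquiv ℚ g).toAlgHom P := fun _ => rfl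
    have hpt : ∀ S : geomTorsion (W.baseChange K) N, ψ (W.geomTorsionOuterConj K g N S) = g • ψ S := by
      intro S
      apply Subtype.ext
      rw [hψ, coe_geomTorsionOuterConj, geomPointsOuterConj_apply, AddSubgroup.torsionBy.coe_smul, hψ,
        hsmul]
      generalize (S : geomPoints (W.baseChange K)) = P
      change ((W.baseChange K).baseChange (AlgebraicClosure K)).toAffine.Point at P
      rcases P with _ | ⟨x, y, h⟩
      · rfl
      · exact Affine.Point.some_eq_some_of_eq (hval' x) (hval' y)
    beta_reduce
    rw [hpt S, hpt T, ← hgal₀, hval]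

/-- **The Weil datum of the row-duality files, with its `τ`-equivariance DISCHARGED.** For `W/ℚ`,
a number field `K` and `N ≥ 2` there is a pairing `e` on `E[N](K̄)` which is `μ_N`-valued,
bilinear, alternating, non-degenerate, `Γ_K`-equivariant (`hgal`), and equivariant under every lift
`τ` of every `σ ∈ Aut(K/ℚ)` to `K̄`: `τ (e S T) = e (τ_* S) (τ_* T)` (`hτe`, `τ_* = IsLiftOfAut.torsionMap`).
[cite: SilvermanAEC2009, Prop. III.8.1 (a)–(d)] [cite: Howard2004HeegnerKolyvagin, §2.3] -/
theorem exists_weilPairing_liftEquivariant (N : ℕ) (hN : 2 ≤ N) :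
    ∃ e : geomTorsion (W.baseChange K) N → geomTorsion (W.baseChange K) N → AlgebraicClosure K,
      (∀ S T, e S T ^ N = 1) ∧
      (∀ S₁ S₂ T, e (S₁ + S₂) T = e S₁ T * e S₂ T) ∧
      (∀ S T₁ T₂, e S (T₁ + T₂) = e S T₁ * e S T₂) ∧
      (∀ T, e T T = 1) ∧
      (∀ T, (∀ S, e S T = 1) → T = 0) ∧
      (∀ (g : absoluteGaloisGroup K) (S T : geomTorsion (W.baseChange K) N),
        g • e S T = e (g • S) (g • T)) ∧
      ∀ (σ : K ≃ₐ[ℚ] K) (τ : AlgebraicClosure K ≃+* AlgebraicClosure K) (hτ : IsLiftOfAut σ τ)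
        (S T : geomTorsion (W.baseChange K) N),
        τ (e S T) = e (hτ.torsionMap W N S) (hτ.torsionMap W N T) := by
  obtain ⟨e, hμ, hadd₁, hadd₂, halt, hnd, hφ⟩ := exists_weilPairing_outerConj_equivariant W K N hN
  refine ⟨e, hμ, hadd₁, hadd₂, halt, hnd, fun g S T => ?_, fun σ τ hτ S T => ?_⟩
  · -- `g ∈ Γ_K`: `ĝ` for `g|_ℚ̄` acts as `g` (`absGaloisTransport_absGaloisRestrict`)
    have hv : g • e S T = absGaloisTransportRat K (absGaloisRestrict ℚ K g) (e S T) :=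
      (absGaloisTransport_absGaloisRestrict g _).symm
    have hp : ∀ S : geomTorsion (W.baseChange K) N,
        g • S = W.geomTorsionOuterConj K (absGaloisRestrict ℚ K g) N S := fun S => by
      apply Subtype.ext
      rw [coe_geomTorsionOuterConj, geomPointsOuterConj_apply, AddSubgroup.torsionBy.coe_smul,
        smul_geomPoints_eq_map_restrictScalars]
      exact congrArg (fun f => Affine.Point.map (W' := W) f (S : geomPoints (W.baseChange K)))
        (AlgHom.ext fun y => (absGaloisTransport_absGaloisRestrict g y).symm)
    rw [hv, hp S, hp T]
    exact hφ _ S T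
  · -- a lift `τ` of `σ`: `τ = ĝ` for `g = ε⁻¹ τ ε`
    obtain ⟨g, hg⟩ := (absGaloisTransport (K := ℚ) (L := K)).surjective hτ.algEquiv
    have hv : τ (e S T) = absGaloisTransportRat K g (e S T) := by
      rw [show absGaloisTransportRat K g = hτ.algEquiv from hg]; rfl
    have hp : ∀ S : geomTorsion (W.baseChange K) N,
        hτ.torsionMap W N S = W.geomTorsionOuterConj K g N S := fun S => by
      apply Subtype.ext
      rw [coe_geomTorsionOuterConj, geomPointsOuterConj_apply, IsLiftOfAut.coe_torsionMap,
        show absGaloisTransportRat K g = hτ.algEquiv from hg]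
      rfl
    rw [hv, hp S, hp T]
    exact hφ g S T

end WeilDatum

end Summit.BirchSwinnertonDyer.Rank1Residual.JET.GlobalDuality

end
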